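import Literature.RingTheory.RegularLocalRing.FrobeniusPowerQuotient
import Literature.RingTheory.RegularLocalRing.EmbeddingDimensionQuotient
import Literature.RingTheory.Localization.LocalQuotientsAtMaximalIdeal
import HarnessLib

/-!
# The Frobenius-power quotient `B ⧸ 𝔫^{[q]}` at a rational point of an affine algebra whose local
# ring is regular: local of embedding dimension `d`, of `k`-dimension `q^d`, a truncated polynomial algebra

`Literature/RingTheory/RegularLocalRing/FrobeniusPowerQuotientAtRationalPoint.lean`, namespace
`Literature.RingTheory.RegularLocalRing` (global form of `SopPowersLength.lean`,
`EmbeddingDimensionQuotient.lean`, `FrobeniusPowerQuotient.lean`, reached through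
`Localization/LocalQuotientsAtMaximalIdeal.lean`). Everything is PROVED; no definitions.

Setting: `k` a field, `B` a commutative `k`-algebra, `𝔫 ⊂ B` a maximal ideal which is a `k`-RATIONAL
point (`k → B ⧸ 𝔫` onto) and finitely generated, `S` a localisation of `B` at `𝔫` which is a REGULAR
local ring of dimension `d` (e.g. `B = 𝒪(U)` for an affine open `U` of a smooth `d`-dimensional
`k`-scheme and `𝔫` the ideal of a rational point), exponential characteristic `p`, `q = pⁿ`, and
`𝔫^{[q]} := 𝔫.map (a ↦ a^q)` the Frobenius power.

* §1 `isLocalRing_quotient_of_pow_le_of_le` — `𝔫ᴺ ⊆ I ⊆ 𝔫` (`𝔫` maximal) ⇒ `B ⧸ I` is local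
  (Atiyah–Macdonald 4.2: powers of a maximal ideal are primary); `pow_le_map_iterateFrobenius` —
  `𝔫^{mq+1} ⊆ 𝔫^{[q]}` for `𝔫` generated by `m` elements; **`isLocalRing_quotient_map_iterateFrobenius`**
  — `B ⧸ 𝔫^{[q]}` is local.
* §2 `map_map_iterateFrobenius_eq_map_maximalIdeal` — `𝔫^{[q]} S = 𝔪_S^{[q]}` (Frobenius commutes with
  localisation).
* §3 **`finrank_quotient_map_iterateFrobenius_atRationalPoint`** —
  **`dim_k (B ⧸ 𝔫^{[q]}) = q^d`** (and finiteness): `B ⧸ 𝔫^{[q]} ≅ S ⧸ 𝔪_S^{[q]}`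
  (`Localization.quotientMap_localization_bijective`) and `SopPowersLength` for `S`;
  **`nonempty_algEquiv_quotient_map_iterateFrobenius_truncated_atRationalPoint`** —
  **`B ⧸ 𝔫^{[q]} ≃ₐ[k] k[X₁, …, X_d] ⧸ (X₁^q, …, X_d^q)`** (`FrobeniusPowerQuotient` for `S`);
  `spanFinrank_maximalIdeal_quotient_map_iterateFrobenius_atRationalPoint` — the embedding dimension
  of `B ⧸ 𝔫^{[q]}` is `d` for `q ≥ 2` (`EmbeddingDimensionQuotient` for `S`).

Scheme reading (not formalised): for a smooth group `G` over `k` and an affine open `U = Spec B ∋ e`,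
the kernel of the `q`-Frobenius `F_q : G → G^{(q)}` is the closed subscheme `Spec(B ⧸ 𝔫_e^{[q]})`; the
three heads are its order `q^{dim G}`, its structure as the truncated polynomial scheme, and
«`Lie(ker F_q) = Lie G`».

## References

* [AtiyahMacdonald1969] Atiyah–Macdonald, Prop. 4.2 (powers of maximal ideals are primary), Prop. 3.11,
  Prop. 4.8, Prop. 8.8 and Example.
* [Matsumura1987] Matsumura, *Commutative Ring Theory*, §14, Thm. 28.3.
* [Kunz1969] E. Kunz, Amer. J. Math. 91 (1969), proof of Thm. 2.1.
-/

set_option autoImplicit false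

namespace Literature.RingTheory.RegularLocalRing

universe u v w

open IsLocalRing Module _root_.MvPolynomial
open Literature.AlgebraicGeometry.Resolution Literature.RingTheory.Localization

/-! ## §1 `B ⧸ 𝔫^{[q]}` is a local ring -/

section Local

variable {B : Type u} [CommRing B] (𝔫 : Ideal B) [h𝔫 : 𝔫.IsMaximal]

/-- **A quotient by an ideal squeezed between a power of a maximal ideal and the maximal ideal is
local**: if `𝔫` is maximal and `𝔫ᴺ ⊆ I ⊆ 𝔫` then `B ⧸ I` is a local ring with maximal ideal `𝔫/I`
(every maximal ideal of `B ⧸ I` pulls back to a prime containing `𝔫ᴺ`, hence to `𝔫`).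
[cite: AtiyahMacdonald1969, Ch. 4, Prop. 4.2] -/
theorem isLocalRing_quotient_of_pow_le_of_le {I : Ideal B} {N : ℕ} (hN : 𝔫 ^ N ≤ I) (hI : I ≤ 𝔫) :
    IsLocalRing (B ⧸ I) := by
  have hItop : I ≠ ⊤ := fun h => h𝔫.ne_top (top_le_iff.mp (h ▸ hI))
  haveI : Nontrivial (B ⧸ I) := Ideal.Quotient.nontrivial_iff.mpr hItop
  have hker : RingHom.ker (Ideal.Quotient.mk I) ≤ 𝔫 := by rw [Ideal.mk_ker]; exact hI
  have hmax : (𝔫.map (Ideal.Quotient.mk I)).IsMaximal := by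
    refine (Ideal.map_eq_top_or_isMaximal_of_surjective _ Ideal.Quotient.mk_surjective h𝔫).resolve_left
      fun htop => h𝔫.ne_top ?_
    have h := congrArg (Ideal.comap (Ideal.Quotient.mk I)) htop
    rwa [Ideal.comap_map_of_surjective _ Ideal.Quotient.mk_surjective, Ideal.comap_top,
      ← RingHom.ker_eq_comap_bot, sup_eq_left.mpr hker] at h
  refine IsLocalRing.of_unique_max_ideal ⟨𝔫.map (Ideal.Quotient.mk I), hmax, fun M hM => ?_⟩
  haveI := hM
  haveI : (M.comap (Ideal.Quotient.mk I)).IsMaximal :=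
    Ideal.comap_isMaximal_of_surjective _ Ideal.Quotient.mk_surjective
  have hle : 𝔫 ≤ M.comap (Ideal.Quotient.mk I) := by
    refine Ideal.IsPrime.le_of_pow_le (n := N) (hN.trans fun x hx => ?_)
    rw [Ideal.mem_comap, Ideal.Quotient.eq_zero_iff_mem.mpr hx]
    exact M.zero_mem
  have heq : M.comap (Ideal.Quotient.mk I) = 𝔫 :=
    (h𝔫.eq_of_le (Ideal.IsMaximal.ne_top inferInstance) hle).symm
  rw [← Ideal.map_comap_of_surjective (Ideal.Quotient.mk I) Ideal.Quotient.mk_surjective M, heq]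

omit h𝔫 in
/-- **`𝔫^{mq+1} ⊆ 𝔫^{[q]}`** for an ideal generated by `m` elements: the Frobenius power
`𝔫^{[pⁿ]} = 𝔫.map (a ↦ a^{pⁿ})` contains a power of `𝔫` ("by looking at monomials", tree
`Kunz1969.pow_span_le_span_pow`). [cite: Kunz1969, Thm. 2.1 (proof)] -/
theorem pow_le_map_iterateFrobenius (p : ℕ) [ExpChar B p] (n : ℕ) {m : ℕ} (y : Fin m → B)
    (hy : Ideal.span (Set.range y) = 𝔫) :
    𝔫 ^ (m * p ^ n + 1) ≤ 𝔫.map (iterateFrobenius B p n) := by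
  rw [← hy, map_iterateFrobenius_span_range]
  exact Kunz1969.pow_span_le_span_pow y (p ^ n)

omit h𝔫 in
/-- `𝔫^{[q]} ⊆ 𝔫` for `q = pⁿ` (indeed `⊆ 𝔫^q`). [cite: Kunz1969, Thm. 2.1 (proof)] -/
theorem map_iterateFrobenius_le_self (p : ℕ) [ExpChar B p] (n : ℕ) :
    𝔫.map (iterateFrobenius B p n) ≤ 𝔫 :=
  (map_iterateFrobenius_le_pow p n 𝔫).trans
    (Ideal.pow_le_self (pow_ne_zero _ (expChar_pos B p).ne'))

/-- **`B ⧸ 𝔫^{[q]}` is a local ring** for a finitely generated maximal ideal `𝔫` and `q = pⁿ`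
(`𝔫^{mq+1} ⊆ 𝔫^{[q]} ⊆ 𝔫`). [cite: AtiyahMacdonald1969, Ch. 4, Prop. 4.2] -/
theorem isLocalRing_quotient_map_iterateFrobenius (hfg : 𝔫.FG) (p : ℕ) [ExpChar B p] (n : ℕ) :
    IsLocalRing (B ⧸ 𝔫.map (iterateFrobenius B p n)) := by
  obtain ⟨m, y, hy⟩ := Submodule.fg_iff_exists_fin_generating_family.mp hfg
  exact isLocalRing_quotient_of_pow_le_of_le 𝔫 (pow_le_map_iterateFrobenius 𝔫 p n y hy)
    (map_iterateFrobenius_le_self 𝔫 p n)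

end Local

/-! ## §2 Frobenius powers commute with localisation -/

section Localization

variable {B : Type u} [CommRing B] (𝔫 : Ideal B) [h𝔫 : 𝔫.IsMaximal]
  (S : Type v) [CommRing S] [Algebra B S] [IsLocalization.AtPrime S 𝔫] [IsLocalRing S]

omit h𝔫 [IsLocalization.AtPrime S 𝔫] [IsLocalRing S] in
/-- Ring homomorphisms commute with the Frobenius: `(I^{[pⁿ]}).map f = (I.map f)^{[pⁿ]}`. [folklore] -/
private theorem map_map_iterateFrobenius_comm (p : ℕ) [ExpChar B p] [ExpChar S p] (n : ℕ)
    (I : Ideal B) :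
    (I.map (iterateFrobenius B p n)).map (algebraMap B S) =
      (I.map (algebraMap B S)).map (iterateFrobenius S p n) := by
  rw [Ideal.map_map, Ideal.map_map]
  congr 1
  ext b
  simp [iterateFrobenius_def, map_pow]

/-- **`𝔫^{[q]} · S = 𝔪_S^{[q]}`**: the extension of the Frobenius power of `𝔫` to the localisation
`S = B_𝔫` is the Frobenius power of the maximal ideal of `S`. [cite: AtiyahMacdonald1969, Ch. 3, Prop. 3.11] -/
theorem map_map_iterateFrobenius_eq_map_maximalIdeal (p : ℕ) [ExpChar B p] [ExpChar S p] (n : ℕ) :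
    (𝔫.map (iterateFrobenius B p n)).map (algebraMap B S) =
      (maximalIdeal S).map (iterateFrobenius S p n) := by
  haveI : 𝔫.IsPrime := h𝔫.isPrime
  rw [map_map_iterateFrobenius_comm, IsLocalization.AtPrime.map_eq_maximalIdeal 𝔫 S]

end Localization

/-! ## §3 Dimension, structure and embedding dimension of `B ⧸ 𝔫^{[q]}` at a rational point -/

section RationalPoint

variable {k : Type w} [Field k] {B : Type u} [CommRing B] [Algebra k B] (𝔫 : Ideal B)
  [h𝔫 : 𝔫.IsMaximal] (S : Type v) [CommRing S] [Algebra B S] [Algebra k S] [IsScalarTower k B S]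
  [IsLocalization.AtPrime S 𝔫]

/-- At a `k`-rational point every element of `S = B_𝔫` is congruent to a scalar modulo `𝔪_S`
(`κ(S) = k`, tree `Localization.algebraMap_residueField_surjective`). [folklore] -/
private theorem hres_localization [IsLocalRing S]
    (hk : Function.Surjective (algebraMap k (B ⧸ 𝔫))) (r : S) :
    ∃ c : k, r - algebraMap k S c ∈ maximalIdeal S := by
  obtain ⟨c, hc⟩ := algebraMap_residueField_surjective k 𝔫 S hk (residue S r)
  refine ⟨c, ?_⟩
  have hc' : residue S (algebraMap k S c) = residue S r := by
    rw [← hc, IsScalarTower.algebraMap_apply k S (ResidueField S), ResidueField.algebraMap_eq]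
  rw [← residue_eq_zero_iff, map_sub, hc', sub_self]

/-- **`dim_k (B ⧸ 𝔫^{[q]}) = q^d` at a rational point with regular local ring of dimension `d`.**
Let `𝔫` be a finitely generated maximal ideal of the `k`-algebra `B` with `k → B ⧸ 𝔫` onto, and let the
localisation `S = B_𝔫` be a regular local ring of dimension `d`. Then for `q = pⁿ` the quotient
`B ⧸ 𝔫^{[q]}` is finite over `k` of dimension `q^d` (`B ⧸ 𝔫^{[q]} ≅ S ⧸ 𝔪_S^{[q]}`, tree
`Localization.finrank_localization_quotient_map_eq`, and `SopPowersLength` for `S`). This is the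
order of the kernel of the `q`-Frobenius of a smooth `d`-dimensional group, read on an affine open
around the origin. [cite: Kunz1969, Thm. 2.1 (proof)] [cite: AtiyahMacdonald1969, Ch. 4, Prop. 4.8] -/
theorem finrank_quotient_map_iterateFrobenius_atRationalPoint [IsRegularLocalRing S]
    (hk : Function.Surjective (algebraMap k (B ⧸ 𝔫))) (hfg : 𝔫.FG) (p : ℕ) [ExpChar B p]
    [ExpChar S p] (n : ℕ) {d : ℕ} (hd : ringKrullDim S = d) :
    Module.Finite k (B ⧸ 𝔫.map (iterateFrobenius B p n)) ∧
      Module.finrank k (B ⧸ 𝔫.map (iterateFrobenius B p n)) = (p ^ n) ^ d := by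
  set I : Ideal B := 𝔫.map (iterateFrobenius B p n) with hI
  haveI : IsLocalRing (B ⧸ I) := isLocalRing_quotient_map_iterateFrobenius 𝔫 hfg p n
  have hIle : I ≤ 𝔫 := map_iterateFrobenius_le_self 𝔫 p n
  -- `B ⧸ I ≅ S ⧸ I S` (`k`-linearly)
  have hle : I ≤ (I.map (algebraMap B S)).comap (IsScalarTower.toAlgHom k B S) := Ideal.le_comap_map
  have hbij := quotientMap_localization_bijective 𝔫 I hIle S
  let e : (B ⧸ I) ≃ₗ[k] (S ⧸ I.map (algebraMap B S)) :=
    LinearEquiv.ofBijective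
      (Ideal.quotientMapₐ (I.map (algebraMap B S)) (IsScalarTower.toAlgHom k B S) hle).toLinearMap hbij
  -- `I S = 𝔪_S^{[q]}` and the count for the regular local ring `S`
  have hIS : I.map (algebraMap B S) = (maximalIdeal S).map (iterateFrobenius S p n) :=
    map_map_iterateFrobenius_eq_map_maximalIdeal 𝔫 S p n
  obtain ⟨hfinS, hdimS⟩ :=
    finrank_quotient_map_iterateFrobenius_maximalIdeal (hres_localization 𝔫 S hk) p n hd
  let e' : (S ⧸ I.map (algebraMap B S)) ≃ₗ[k] (S ⧸ (maximalIdeal S).map (iterateFrobenius S p n)) :=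
    (Ideal.quotientEquivAlgOfEq k hIS).toLinearEquiv
  haveI : Module.Finite k (S ⧸ I.map (algebraMap B S)) := Module.Finite.equiv e'.symm
  refine ⟨Module.Finite.equiv e.symm, ?_⟩
  rw [e.finrank_eq, e'.finrank_eq, hdimS]

/-- **`B ⧸ 𝔫^{[q]} ≃ₐ[k] k[X₁, …, X_d] ⧸ (X₁^q, …, X_d^q)` at a rational point with regular local ring of
dimension `d`** (same hypotheses): the Frobenius-power quotient is the truncated polynomial algebra
(`FrobeniusPowerQuotient` for `S = B_𝔫`, transported along `B ⧸ 𝔫^{[q]} ≅ S ⧸ 𝔪_S^{[q]}`). Scheme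
reading: the kernel of the `q`-Frobenius of a smooth `d`-dimensional group is
`Spec k[X₁, …, X_d] ⧸ (Xᵢ^q)`. [cite: Matsumura1987, Thm. 28.3] [cite: AtiyahMacdonald1969, Ch. 4, Prop. 4.8] -/
theorem nonempty_algEquiv_quotient_map_iterateFrobenius_truncated_atRationalPoint
    [IsRegularLocalRing S] (hk : Function.Surjective (algebraMap k (B ⧸ 𝔫))) (hfg : 𝔫.FG)
    (p : ℕ) [ExpChar B p] [ExpChar S p] (n : ℕ) {d : ℕ} (hd : ringKrullDim S = d) :
    Nonempty ((B ⧸ 𝔫.map (iterateFrobenius B p n)) ≃ₐ[k]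
      (MvPolynomial (Fin d) k ⧸
        Ideal.span (Set.range fun i => (X i : MvPolynomial (Fin d) k) ^ p ^ n))) := by
  set I : Ideal B := 𝔫.map (iterateFrobenius B p n) with hI
  haveI : IsLocalRing (B ⧸ I) := isLocalRing_quotient_map_iterateFrobenius 𝔫 hfg p n
  have hIle : I ≤ 𝔫 := map_iterateFrobenius_le_self 𝔫 p n
  have hle : I ≤ (I.map (algebraMap B S)).comap (IsScalarTower.toAlgHom k B S) := Ideal.le_comap_map
  have hbij := quotientMap_localization_bijective 𝔫 I hIle S
  let e : (B ⧸ I) ≃ₐ[k] (S ⧸ I.map (algebraMap B S)) :=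
    AlgEquiv.ofBijective
      (Ideal.quotientMapₐ (I.map (algebraMap B S)) (IsScalarTower.toAlgHom k B S) hle) hbij
  have hIS : I.map (algebraMap B S) = (maximalIdeal S).map (iterateFrobenius S p n) :=
    map_map_iterateFrobenius_eq_map_maximalIdeal 𝔫 S p n
  obtain ⟨ε⟩ := nonempty_algEquiv_quotient_map_iterateFrobenius_truncated
    (hres_localization 𝔫 S hk) p n hd
  exact ⟨(e.trans (Ideal.quotientEquivAlgOfEq k hIS)).trans ε⟩

omit [IsScalarTower k B S] in
/-- **The embedding dimension of `B ⧸ 𝔫^{[q]}` is `d`** for `q = pⁿ ≥ 2` (same setting, `S = B_𝔫`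
regular local of dimension `d`): `B ⧸ 𝔫^{[q]} ≅ S ⧸ 𝔪_S^{[q]}` as rings and
`EmbeddingDimensionQuotient` for `S`. Scheme reading: «`Lie(ker F_q) = Lie G`».
[cite: Matsumura1987, §14 and Thm. 2.3] -/
theorem spanFinrank_maximalIdeal_quotient_map_iterateFrobenius_atRationalPoint
    [IsRegularLocalRing S] (p : ℕ) [ExpChar B p] [ExpChar S p] (n : ℕ)
    (hq : 2 ≤ p ^ n) {d : ℕ} (hd : ringKrullDim S = d)
    [IsLocalRing (B ⧸ 𝔫.map (iterateFrobenius B p n))] :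
    (maximalIdeal (B ⧸ 𝔫.map (iterateFrobenius B p n))).spanFinrank = d := by
  set I : Ideal B := 𝔫.map (iterateFrobenius B p n) with hI
  have hIle : I ≤ 𝔫 := map_iterateFrobenius_le_self 𝔫 p n
  have hbij := quotientMap_localization_bijective 𝔫 I hIle S
  have hIS : I.map (algebraMap B S) = (maximalIdeal S).map (iterateFrobenius S p n) :=
    map_map_iterateFrobenius_eq_map_maximalIdeal 𝔫 S p n
  -- the target quotient of `S` is local (quotient of a local ring by a proper ideal)
  have hJle : (maximalIdeal S).map (iterateFrobenius S p n) ≤ maximalIdeal S :=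
    map_iterateFrobenius_le_self (maximalIdeal S) p n
  have hJtop : (maximalIdeal S).map (iterateFrobenius S p n) ≠ ⊤ := fun h =>
    (maximalIdeal.isMaximal S).ne_top (top_le_iff.mp (h ▸ hJle))
  haveI : Nontrivial (S ⧸ (maximalIdeal S).map (iterateFrobenius S p n)) :=
    Ideal.Quotient.nontrivial_iff.mpr hJtop
  haveI : IsLocalRing (S ⧸ (maximalIdeal S).map (iterateFrobenius S p n)) :=
    IsLocalRing.of_surjective' (Ideal.Quotient.mk _) Ideal.Quotient.mk_surjective
  let e : (B ⧸ I) ≃+* (S ⧸ (maximalIdeal S).map (iterateFrobenius S p n)) :=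
    (RingEquiv.ofBijective _ hbij).trans (Ideal.quotientEquivAlgOfEq B hIS).toRingEquiv
  rw [← spanFinrank_maximalIdeal_quotient_map_iterateFrobenius_of_isRegularLocalRing p n hq hd,
    ← map_ringEquiv_maximalIdeal e, Ideal.spanFinrank_map_eq_of_ringEquiv]

end RationalPoint

end Literature.RingTheory.RegularLocalRing
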